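import Literature.GroupTheory.CombinatorialGroupTheory.QuadraticWordsVertexDefs
import Literature.GroupTheory.CombinatorialGroupTheory.PermutationCycleSurgery
import HarnessLib

/-!
# Transport moves preserve one-vertex quadratic words

Topic `Literature/GroupTheory/CombinatorialGroupTheory`; continues `QuadraticWordsVertexDefs.lean`.
The transport moves of `QuadraticWords.lean` / `QuadraticWordsGathering.lean` (ZVC 3.2.2
bifurcations, realised there by transvections of the free group) — `A y B W ȳ C ↦ A y W B ȳ C`
and `A y M ȳ D C ↦ A D y M ȳ C` — are cut-and-paste operations on the polygon, so they do not
change the vertices.  Algebraically: the new vertex permutation is the old one composed with a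
3-cycle of corners `(ȳ, B̄ₗ, W̄ₗ)` met in this cyclic order (`W̄ₗ` is the corner just before `ȳ`),
and a cycle composed with such a 3-cycle stays a cycle (`sameCycle_of_threeCycle`).

* `VertexTransitive.transport_core` — `y B W ȳ R' ↦ y W B ȳ R'`;
* `VertexTransitive.transport`, `VertexTransitive.transport_out`, `VertexTransitive.transport_in` — the templates with a
  prefix, obtained by rotation.

## References

* H. Zieschang, E. Vogt, H.-D. Coldewey, *Surfaces and Planar Discontinuous Groups*, LNM 835,
  Springer 1980, §1.3, 3.2.2. [ZieschangVogtColdewey1980]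
-/

namespace Literature.GroupTheory.CombinatorialGroupTheory

open List Equiv Equiv.Perm

section Words

variable {ι : Type*} [DecidableEq ι]

omit [DecidableEq ι] in
/-- Membership in a cons-append word, split by blocks. [folklore] -/
private theorem mem_split4 {y : ι × Bool} {B W R : List (ι × Bool)} {x : ι × Bool}
    (hx : x ∈ y :: (B ++ W ++ R)) : x = y ∨ x ∈ B ∨ x ∈ W ∨ x ∈ R := by
  simpa [or_assoc] using hx

/-- **Transport preserves one-vertex words** (core form, word read from the moved symbol):
`y B W ȳ R' ↦ y W B ȳ R'`.  The new vertex permutation is the old one composed with the 3-cycle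
`(ȳ, B̄ₗ, W̄ₗ)` of corners taken in cyclic order, so a single vertex stays a single vertex
(cut-and-paste of the polygon, ZVC 3.2.2). [cite: ZieschangVogtColdewey1980, 3.2.2] -/
theorem VertexTransitive.transport_core [Fintype ι] {y : ι × Bool} {B W R' : List (ι × Bool)}
    (h : VertexTransitive (y :: (B ++ W ++ bar y :: R'))) (hd : (y :: (B ++ W ++ bar y :: R')).Nodup)
    (hcl : Closed (y :: (B ++ W ++ bar y :: R'))) :
    VertexTransitive (y :: (W ++ B ++ bar y :: R')) := by
  rcases eq_or_ne B [] with rfl | hB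
  · simpa using h
  rcases eq_or_ne W [] with rfl | hW
  · simpa using h
  set R := bar y :: R' with hR
  set w₁ := y :: (B ++ W ++ R) with hw₁
  set w₂ := y :: (W ++ B ++ R) with hw₂
  -- first and last letters of the two blocks
  obtain ⟨b₀, B', hB0⟩ := exists_cons_of_ne_nil hB
  obtain ⟨w₀, W', hW0⟩ := exists_cons_of_ne_nil hW
  set Bl := B.getLast hB with hBl
  set Wl := W.getLast hW with hWl
  set D := B.dropLast with hD
  set E := W.dropLast with hE
  have hBD : D ++ [Bl] = B := dropLast_append_getLast hB
  have hWE : E ++ [Wl] = W := dropLast_append_getLast hW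
  have hperm : w₁ ~ w₂ := Perm.cons y (perm_append_comm.append_right R)
  have hd₂ : w₂.Nodup := hd.perm hperm
  have hR0 : R ≠ [] := cons_ne_nil _ _
  -- disjointness facts
  have hd' : (B ++ W ++ R).Nodup := (nodup_cons.1 hd).2
  have hyB : y ∉ B := fun h' => (nodup_cons.1 hd).1 (by simp [h'])
  have hyW : y ∉ W := fun h' => (nodup_cons.1 hd).1 (by simp [h'])
  have hBW : ∀ x ∈ B, x ∉ W := fun x hx hx' =>
    disjoint_of_nodup_append (append_assoc B W R ▸ hd') hx (mem_append_left _ hx')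
  have hWlW : Wl ∈ W := getLast_mem hW
  have hBlB : Bl ∈ B := getLast_mem hB
  -- the six special values
  have e11 : w₁.formPerm y = b₀ := by
    have ew : w₁ = [] ++ y :: b₀ :: (B' ++ W ++ R) := by rw [hw₁, hB0]; simp
    rw [ew]; exact formPerm_apply_mid _ _ _ _ (by rw [← ew]; exact hd)
  have e12 : w₁.formPerm Bl = w₀ := by
    have ew : w₁ = (y :: D) ++ Bl :: w₀ :: (W' ++ R) := by rw [hw₁, ← hBD, hW0]; simp
    rw [ew]; exact formPerm_apply_mid _ _ _ _ (by rw [← ew]; exact hd)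
  have e13 : w₁.formPerm Wl = bar y := by
    have ew : w₁ = (y :: (B ++ E)) ++ Wl :: bar y :: R' := by rw [hw₁, ← hWE]; simp [hR]
    rw [ew]; exact formPerm_apply_mid _ _ _ _ (by rw [← ew]; exact hd)
  have e21 : w₂.formPerm y = w₀ := by
    have ew : w₂ = [] ++ y :: w₀ :: (W' ++ B ++ R) := by rw [hw₂, hW0]; simp
    rw [ew]; exact formPerm_apply_mid _ _ _ _ (by rw [← ew]; exact hd₂)
  have e22 : w₂.formPerm Wl = b₀ := by
    have ew : w₂ = (y :: E) ++ Wl :: b₀ :: (B' ++ R) := by rw [hw₂, ← hWE, hB0]; simp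
    rw [ew]; exact formPerm_apply_mid _ _ _ _ (by rw [← ew]; exact hd₂)
  have e23 : w₂.formPerm Bl = bar y := by
    have ew : w₂ = (y :: (W ++ D)) ++ Bl :: bar y :: R' := by rw [hw₂, ← hBD]; simp [hR]
    rw [ew]; exact formPerm_apply_mid _ _ _ _ (by rw [← ew]; exact hd₂)
  -- elsewhere the successor is unchanged
  have hl₁ : (y :: (B ++ W ++ R)).getLast (cons_ne_nil _ _) = R.getLast hR0 := by
    rw [getLast_cons (by simp [hR]), getLast_append_right hR0]
  have hl₂ : (y :: (W ++ B ++ R)).getLast (cons_ne_nil _ _) = R.getLast hR0 := by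
    rw [getLast_cons (by simp [hR]), getLast_append_right hR0]
  have eelse : ∀ x, x ≠ y → x ≠ Bl → x ≠ Wl → w₂.formPerm x = w₁.formPerm x := by
    intro x hxy hxB hxW
    by_cases hxw : x ∈ w₂
    · rcases mem_split4 hxw with rfl | hx | hx | hx
      · exact absurd rfl hxy
      · obtain ⟨W₁, x', W₂, hWx⟩ := exists_split_succ hx fun _ => hxW
        have ew₁ : w₁ = (y :: (B ++ W₁)) ++ x :: x' :: (W₂ ++ R) := by rw [hw₁, hWx]; simp
        have ew₂ : w₂ = (y :: W₁) ++ x :: x' :: (W₂ ++ B ++ R) := by rw [hw₂, hWx]; simp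
        rw [ew₁, ew₂, formPerm_apply_mid (y :: W₁) (W₂ ++ B ++ R) x x' (by rw [← ew₂]; exact hd₂),
          formPerm_apply_mid (y :: (B ++ W₁)) (W₂ ++ R) x x' (by rw [← ew₁]; exact hd)]
      · obtain ⟨B₁, x', B₂, hBx⟩ := exists_split_succ hx fun _ => hxB
        have ew₁ : w₁ = (y :: B₁) ++ x :: x' :: (B₂ ++ W ++ R) := by rw [hw₁, hBx]; simp
        have ew₂ : w₂ = (y :: (W ++ B₁)) ++ x :: x' :: (B₂ ++ R) := by rw [hw₂, hBx]; simp
        rw [ew₁, ew₂, formPerm_apply_mid (y :: (W ++ B₁)) (B₂ ++ R) x x' (by rw [← ew₂]; exact hd₂),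
          formPerm_apply_mid (y :: B₁) (B₂ ++ W ++ R) x x' (by rw [← ew₁]; exact hd)]
      · by_cases hxl : x = R.getLast hR0
        · show (y :: (W ++ B ++ R)).formPerm x = (y :: (B ++ W ++ R)).formPerm x
          rw [formPerm_apply_getLast_eq_head y _ (hxl.trans hl₁.symm),
            formPerm_apply_getLast_eq_head y _ (hxl.trans hl₂.symm)]
        · obtain ⟨R₁, x', R₂, hRx⟩ := exists_split_succ hx fun _ => hxl
          have ew₁ : w₁ = (y :: (B ++ W ++ R₁)) ++ x :: x' :: R₂ := by rw [hw₁, hRx]; simp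
          have ew₂ : w₂ = (y :: (W ++ B ++ R₁)) ++ x :: x' :: R₂ := by rw [hw₂, hRx]; simp
          rw [ew₁, ew₂, formPerm_apply_mid (y :: (W ++ B ++ R₁)) R₂ x x' (by rw [← ew₂]; exact hd₂),
            formPerm_apply_mid (y :: (B ++ W ++ R₁)) R₂ x x' (by rw [← ew₁]; exact hd)]
    · rw [formPerm_apply_of_notMem hxw, formPerm_apply_of_notMem fun h' => hxw (hperm.mem_iff.1 h')]
  -- the 3-cycle lemma
  have hab : bar y ≠ bar Bl := fun h' => hyB (bar_injective h' ▸ hBlB)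
  have hbc : bar Bl ≠ bar Wl := fun h' => hBW Bl hBlB (bar_injective h' ▸ hWlW)
  have hac : bar y ≠ bar Wl := fun h' => hyW (bar_injective h' ▸ hWlW)
  have hyw : bar y ∈ w₁ := by simp [hw₁, hR]
  have hbw : bar Bl ∈ w₁ := hcl _ (by simp [hw₁, hBlB])
  have key : ∀ x, (vertexPerm w₁).SameCycle (bar y) x → (vertexPerm w₂).SameCycle (bar y) x := by
    intro x hx
    refine sameCycle_of_threeCycle (ρ := vertexPerm w₁) (a := bar y) (b := bar Bl) (c := bar Wl)
      hab ?_ ?_ ?_ ?_ ?_ (h _ hyw _ hbw) hx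
    · rw [vertexPerm_apply, bar_bar, e13]
    · rw [vertexPerm_apply, vertexPerm_apply, bar_bar, bar_bar, e21, e12]
    · rw [vertexPerm_apply, bar_bar, e23]
    · rw [vertexPerm_apply, vertexPerm_apply, bar_bar, bar_bar, e22, e11]
    · intro x h1 h2 h3
      rw [vertexPerm_apply, vertexPerm_apply]
      exact eelse (bar x) (fun e => h1 (by rw [← e, bar_bar])) (fun e => h2 (by rw [← e, bar_bar]))
        (fun e => h3 (by rw [← e, bar_bar]))
  intro x hx z hz
  exact (key x (h _ hyw _ (hperm.mem_iff.2 hx))).symm.trans (key z (h _ hyw _ (hperm.mem_iff.2 hz)))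

/-- **Transport inside a pair preserves one-vertex words**: `A y B W ȳ C ↦ A y W B ȳ C`
(the move realised by `transv_mk_transport_left/right`). [cite: ZieschangVogtColdewey1980, 3.2.2] -/
theorem VertexTransitive.transport [Fintype ι] {y : ι × Bool} {A B W C : List (ι × Bool)}
    (h : VertexTransitive (A ++ y :: (B ++ W ++ bar y :: C)))
    (hd : (A ++ y :: (B ++ W ++ bar y :: C)).Nodup) (hcl : Closed (A ++ y :: (B ++ W ++ bar y :: C))) :
    VertexTransitive (A ++ y :: (W ++ B ++ bar y :: C)) := by
  have r₁ : (A ++ y :: (B ++ W ++ bar y :: C)) ~r (y :: (B ++ W ++ bar y :: (C ++ A))) := by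
    simpa using isRotated_append (l := A) (l' := y :: (B ++ W ++ bar y :: C))
  have r₂ : (A ++ y :: (W ++ B ++ bar y :: C)) ~r (y :: (W ++ B ++ bar y :: (C ++ A))) := by
    simpa using isRotated_append (l := A) (l' := y :: (W ++ B ++ bar y :: C))
  have hp : (A ++ y :: (B ++ W ++ bar y :: C)) ~ (A ++ y :: (W ++ B ++ bar y :: C)) :=
    ((perm_append_comm.append_right (bar y :: C)).cons y).append_left A
  have h₁ := (vertexTransitive_iff_of_isRotated hd r₁).1 h
  have h₂ := h₁.transport_core (r₁.perm.nodup_iff.1 hd) (hcl.of_perm r₁.perm)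
  exact (vertexTransitive_iff_of_isRotated (hp.nodup_iff.1 hd) r₂).2 h₂

/-- **Transport across a pair preserves one-vertex words**: `A y M ȳ D C ↦ A D y M ȳ C`
(the move realised by `transv_mk_transport_out/in`). [cite: ZieschangVogtColdewey1980, 3.2.2] -/
theorem VertexTransitive.transport_out [Fintype ι] {y : ι × Bool} {A M D C : List (ι × Bool)}
    (h : VertexTransitive (A ++ y :: (M ++ bar y :: (D ++ C))))
    (hd : (A ++ y :: (M ++ bar y :: (D ++ C))).Nodup)
    (hcl : Closed (A ++ y :: (M ++ bar y :: (D ++ C)))) :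
    VertexTransitive (A ++ D ++ y :: (M ++ bar y :: C)) := by
  have r₁ : (A ++ y :: (M ++ bar y :: (D ++ C))) ~r (bar y :: (D ++ (C ++ A) ++ bar (bar y) :: M)) := by
    rw [bar_bar]
    simpa using isRotated_append (l := A ++ y :: M) (l' := bar y :: (D ++ C))
  have r₂ : (A ++ D ++ y :: (M ++ bar y :: C)) ~r (bar y :: ((C ++ A) ++ D ++ bar (bar y) :: M)) := by
    rw [bar_bar]
    simpa using isRotated_append (l := A ++ D ++ y :: M) (l' := bar y :: C)
  have hp : (A ++ y :: (M ++ bar y :: (D ++ C))) ~ (A ++ D ++ y :: (M ++ bar y :: C)) := by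
    refine r₁.perm.trans (Perm.trans ?_ r₂.perm.symm)
    exact Perm.cons _ (perm_append_comm.append_right _)
  have h₁ := (vertexTransitive_iff_of_isRotated hd r₁).1 h
  have h₂ := h₁.transport_core (r₁.perm.nodup_iff.1 hd) (hcl.of_perm r₁.perm)
  exact (vertexTransitive_iff_of_isRotated (hp.nodup_iff.1 hd) r₂).2 h₂

/-- The reverse move `A D y M ȳ C ↦ A y M ȳ D C` also preserves one-vertex words. [cite: ZieschangVogtColdewey1980, 3.1.5] -/
theorem VertexTransitive.transport_in [Fintype ι] {y : ι × Bool} {A M D C : List (ι × Bool)}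
    (h : VertexTransitive (A ++ D ++ y :: (M ++ bar y :: C)))
    (hd : (A ++ D ++ y :: (M ++ bar y :: C)).Nodup)
    (hcl : Closed (A ++ D ++ y :: (M ++ bar y :: C))) :
    VertexTransitive (A ++ y :: (M ++ bar y :: (D ++ C))) := by
  have r₁ : (A ++ D ++ y :: (M ++ bar y :: C)) ~r (bar y :: ((C ++ A) ++ D ++ bar (bar y) :: M)) := by
    rw [bar_bar]
    simpa using isRotated_append (l := A ++ D ++ y :: M) (l' := bar y :: C)
  have r₂ : (A ++ y :: (M ++ bar y :: (D ++ C))) ~r (bar y :: (D ++ (C ++ A) ++ bar (bar y) :: M)) := by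
    rw [bar_bar]
    simpa using isRotated_append (l := A ++ y :: M) (l' := bar y :: (D ++ C))
  have hp : (A ++ D ++ y :: (M ++ bar y :: C)) ~ (A ++ y :: (M ++ bar y :: (D ++ C))) := by
    refine r₁.perm.trans (Perm.trans ?_ r₂.perm.symm)
    exact Perm.cons _ (perm_append_comm.append_right _)
  have h₁ := (vertexTransitive_iff_of_isRotated hd r₁).1 h
  have h₂ := h₁.transport_core (r₁.perm.nodup_iff.1 hd) (hcl.of_perm r₁.perm)
  exact (vertexTransitive_iff_of_isRotated (hp.nodup_iff.1 hd) r₂).2 h₂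

end Words

end Literature.GroupTheory.CombinatorialGroupTheory
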